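import Literature.NumberTheory.EllipticCurves.Kato2004.TateModuleFilAtInertiaProofs
import Literature.NumberTheory.EllipticCurves.TorsionFilAtCountMultiplicativeThreeProofs
import Literature.NumberTheory.EllipticCurves.LocalPointsModKernelOfReductionMultiplicativeProofs
import Literature.NumberTheory.EllipticCurves.TateCurve.MultiplicativeTwistUnramifiedProofs
import Literature.NumberTheory.EllipticCurves.TateCurve.InertiaTorsionOfTateParameterPower
import Literature.NumberTheory.EllipticCurves.TateCurve.TransvectionOfTateParameterNotPower
import Literature.NumberTheory.EllipticCurves.KodairaNeronUnramifiedInertiaProofs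
import Literature.NumberTheory.EllipticCurves.FramedTateGaloisRep
import Literature.NumberTheory.GaloisRepresentations.OrdinaryGaloisRep
import Literature.NumberTheory.Automorphic.CDTTheorem722
import HarnessLib

/-!
# Stub ideation k3 · GEN 9 · `stub_liftThree` (crux `FreyModularity`, stmt-ABC-11340, line `Sketch`)

HOME FAMILY 3 — PROBE THE EXTREMES, technique (e) PERTURBATION FROM THE PROVED NEIGHBOURING CASE, run on
the ONE helper of this slot's ranked list that is provable now and NEW (gen-7 **L2** = «multiplicative place ⇒
ordinary line», rank 1 of the gen-8 final list), plus technique (a)'s DEGENERATE-INSTANCE check on its typing.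
Companion file: elaboration sanity only (nothing registered, nothing touches `Lines/Sketch.lean`); gens 2–8
(`STUB_IDEAS_stub_liftThree_3*.lean`) stay valid by reference.  OUTCOME OF THE SANITY PASS: the whole critical
path M1a → M1 → M2 → M3 → M4core → M4 (= L2 at `p = 3` over `ℚ`) → M5 is PROVED below, sorry-free
(`#print axioms` of M5 = `[propext, Classical.choice, Quot.sound]`, `lean check` rc 0); the only `sorry`s left are the
off-`p` typing guard M0/M0′ (§1), which nothing on the path uses.  What remains for a prover is to LAND it
(one Literature file, D-0064) and to feed M4 into the framed predicate (gen-7 L2f / liftFive A3).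

The stub (S1b, `Lines/Sketch.lean:157`):
`∀ W ρ, W.IsTorsionGaloisRep 3 ρ → ρ.IsAbsIrreducibleOverSqrt (-3) → ¬ 9 ∣ N(W) → ρ.IsModular → W.IsModularGaloisRepTate 3`.
Under `¬ 9 ∣ N(W)` the curve is SEMISTABLE AT `3`: the local deformation condition at `3` is one of TWO cells,
good-ordinary/flat (cell γ, tree: `ellipticOrdinaryReduction_tateModule_filtration_holds`,
`Kato2004.tateModuleFilAt_inertia_ordinary_holds` — PROVED) or MULTIPLICATIVE (cells β₀/β₁ — gen-7 L2, sorried in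
gens 7–8 with a «Tate uniformisation + Kummer on `rationalTateModule`» plan and no sub-lemmas; PROVED HERE at `p = 3`
over `ℚ`, §5).

## What GEN 9 adds (and only this)

THREE proved neighbours of L2 now sit in the tree, all landed 2026-08-25…30, none used by gens 2–8 of this slot:

* (N1) `Kato2004.tateModuleFilAt_inertia_ordinary_holds` — the GOOD-ORDINARY twin of L2 in the integral
  currency `F⁺_v T_pE = tateModuleFilAt W p v`, with a 5-step proof `(i)`–`(v)` whose only reduction-type inputs are
  «inertia moves `T_pE` into `F⁺`» and «an ordinary point lies outside the saturated `F⁺`»;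
* (N2) `WeierstrassCurve.smul_eq_of_mem_inertia_of_pow_eq_tateParameter` — the MULTIPLICATIVE case at the
  extreme «Tate parameter an `n`-th power» (Kummer cocycle ≡ 0: inertia fixing `μ_n` fixes `E[n]`), any `n`, `v ∣ n`
  allowed; its sibling `exists_transvection_of_forall_pow_ne_tateParameter` is the opposite extreme;
* (N3) `natCard_torsionFilAt_pow_eq_of_hasMultiplicativeReductionAt_three`,
  `exists_not_mem_torsionFilAt_of_hasMultiplicativeReductionAt_three`,
  `exists_ne_zero_mem_torsionFilAt_three_of_hasMultiplicativeReductionAt_three` — AT `p = 3` EXACTLY, the level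
  structure of `Fil_v E[3^k]` at a multiplicative `v ∋ 3` (tree theorems; at `p = 5` these are the liftFive F-series ports).

Perturbing (N2) off its extreme gives M1a below («an inertia element moves every `p^k`-torsion point of `E(K̄_v)`
by `Ψ(ζ)`, `ζ ∈ μ_{p^k} ⊂ 1 + 𝔪` — INTO `E₁`»), i.e. clause (1) of (N1) at a multiplicative `v ∣ p`; running
(N1)'s steps `(i)`–`(v)` with M1 in place of `absGaloisRestrict_smul_sub_mem_tateModuleFilAt`, (N3) in place of
the ordinary point, and `F ≠ ⊥ ⇐ det = χ_cyc` (M2) in place of Greenberg's a-priori line, proves L2 at `p = 3`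
over `ℚ` (M4) and the integral scalar law (M5) — ALL CARRIED OUT BELOW (M1a, M1, M2, M3, M4core, M4, M5 proved;
≈ 330 lines; M0/M0′ sorried guards).

DEDUP ACROSS LINEAGES (for the critic): gen-7 L2 (`HasOrdinaryLineAt`, this slot) ≡ liftFive-k3 P2
`MultiplicativeOrdinaryFiltrationShape` (`STUB_IDEAS_stub_liftFive_3g8.lean`, same four clauses, `Iff.rfl`) ⇐
liftFive-k1 W1 + W1b (`STUB_IDEAS_stub_liftFive_1g5.lean`, integral currency, generic `p`, `W/ℚ`, sorried); M1a =
liftFive-k3-g7 «L7» made precise; M1 = W1 clause (1) over any number field; M5 = W1 clause (2) at `p = 3`.  ONE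
generic-`p` Literature file `NumberTheory/EllipticCurves/MultiplicativeOrdinaryFiltrationProofs.lean` (D-0064;
M0, M1a, M1, M2 generic; M3–M5 at `p = 3` now, at every `p` once liftFive's F-series B2 lands) closes L2 here, P2/W1 at
`ℓ = 5`, and is BSD-bankable (Greenberg's exceptional-zero local condition).

DEGENERATE INSTANCE (family 3 (a), the typing guard): OFF `p` the filtration is EMPTY — `Fil_v E[p^k] = 0` and
`F⁺_v T_pE = ⊥` for `v ∤ p` (M0: `E₁` has no prime-to-`p` torsion, tree `val_le_one_of_zsmul_eq_zero`) — while the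
inertia group at a multiplicative `v ∤ p` is NOT trivial on `T_pE` (tree `exists_transvection_of_forall_pow_ne_tateParameter`,
Tate parameter not a `p`-th power).  Hence M1/M1a are FALSE without `hpv : p ∈ v` (cheapest refutation of the
mis-typed variant), every `tateModuleFilAt`-phrased ordinary statement must carry `v ∣ p` (W1/W1b do; gen-7's
`HasOrdinaryLineAt`-L2 «`v ∣ p` or not» is true off `p` only through the Kummer line `V_p(μ)`, which is NOT
`ℚ_p ⊗ F⁺_v` there), and for THIS stub only `v ∣ 3` is consumed.
-/

set_option linter.dupNamespace false
set_option linter.unusedVariables false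

noncomputable section

open scoped MatrixGroups NumberField
open Matrix Field NumberField IsDedekindDomain IsDedekindDomain.HeightOneSpectrum
open Literature.NumberTheory.EllipticCurves Literature.NumberTheory.EllipticCurves.Kato2004
open Literature.NumberTheory.EllipticCurves.TateCurve
open Literature.NumberTheory.Automorphic Literature.NumberTheory.Automorphic.BCDT
open Literature.NumberTheory.GaloisRepresentations
open Literature.NumberTheory.GaloisRepresentations.ModPGaloisRep
open Literature.NumberTheory.DiophantineGeometry
open WeierstrassCurve

namespace Summit.ABC.ABC.Cruxes.FreyModularity.StubIdeas3G9

/-- `3` is prime (instance for the `p = 3` statements, as in gens 3–8). -/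
instance instFactNatPrimeThree : Fact (Nat.Prime 3) := ⟨Nat.prime_three⟩

/-! ## §0 The stub and the predicate, verbatim -/

/-- The stub `stub_liftThree` of `Lines/Sketch.lean`, verbatim (= `StubIdeas3G8.LiftThree`). -/
def LiftThree : Prop :=
  ∀ (W : WeierstrassCurve ℚ) [W.IsElliptic] (ρ : ModPGaloisRep ℚ (ZMod 3) 2),
    W.IsTorsionGaloisRep 3 ρ → ρ.IsAbsIrreducibleOverSqrt (-3) → ¬ 9 ∣ W.conductorNorm ℤ →
      ρ.IsModular → W.IsModularGaloisRepTate 3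

/-- `HasOrdinaryLineAt W p v` — VERBATIM gen-7 (`StubIdeas3G7.HasOrdinaryLineAt`, `Iff.rfl`) = the conclusion of
the tree's `ellipticOrdinaryReduction_tateModule_filtration` = liftFive P2's four clauses: a `Γ_{K_v}`-stable
`ℚ_p`-line `L ⊂ V_pE`, inertia acting through `χ_p` on `L` and trivially on `V_pE/L`. [cite: Greenberg1991, §2 (p. 214)] -/
def HasOrdinaryLineAt {K : Type} [Field K] [NumberField K] (W : WeierstrassCurve K) [W.IsElliptic]
    (p : ℕ) [Fact p.Prime] (v : HeightOneSpectrum (𝓞 K)) : Prop :=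
  ∃ L : Submodule (Padic p) (W.rationalTateModule p),
    Module.finrank (Padic p) L = 1 ∧
    (∀ (τ : absoluteGaloisGroup (v.adicCompletion K)), ∀ x ∈ L,
      W.rationalGaloisRepTate p (absGaloisRestrict K (v.adicCompletion K) τ) x ∈ L) ∧
    (∀ τ ∈ absInertia (v.adicCompletion K), ∀ x ∈ L,
      W.rationalGaloisRepTate p (absGaloisRestrict K (v.adicCompletion K) τ) x =
        (((GaloisRep.cyclotomicCharacter (v.adicCompletion K) p τ : (PadicInt p)ˣ) : PadicInt p) :
          Padic p) • x) ∧
    (∀ τ ∈ absInertia (v.adicCompletion K), ∀ x : W.rationalTateModule p,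
      W.rationalGaloisRepTate p (absGaloisRestrict K (v.adicCompletion K) τ) x - x ∈ L)

/-! ## §1 M0 — the degenerate instance `v ∤ p`: the filtration is empty (typing guard, XS–S) -/

section OffP

variable {K : Type} [Field K] [NumberField K] (W : WeierstrassCurve K) [W.IsElliptic]
  (p : ℕ) [Fact p.Prime] (v : HeightOneSpectrum (𝓞 K))

/-- **M0 · `Fil_v E[p^k] = 0` for `v ∤ p`** (any reduction type): the kernel of reduction `E₁(K̄_v)` has no
prime-to-`p` torsion — a point `P = (x, y)` of `E(K̄_v)` on the `v`-integral spectral model with `n • P = 0`,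
`|n|_v = 1`, has `|x|_v ≤ 1` (tree `val_le_one_of_zsmul_eq_zero`, Silverman VII.3.1(a) in valuation form), whereas
`E₁` is `|x|_v > 1` (`mem_localKernelOfReduction_iff`).  One cycle, XS–S: unfold `mem_torsionFilAt_iff`, transport to
the spectral model (`localPointsEquivSpectralModel`), `spectralValuation_natCast_eq_one_of_isUnit` for `|p^k|_v = 1`.
CONSEQUENCE (the guard): `tateModuleFilAt W p v = ⊥` off `p`, so M1/M1a below are FALSE without `p ∈ v`
(inertia at a multiplicative `v ∤ p` with Tate parameter `∉ (K_vˣ)^p` contains a transvection: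
`exists_transvection_of_forall_pow_ne_tateParameter`). [cite: SilvermanAEC2009, VII.3 Prop. 3.1(a), VII.2 Prop. 2.2]
[cite: SilvermanATAEC1994, V Ex. 5.13 (b)] -/
theorem torsionFilAt_eq_bot_of_not_mem (hpv : ((p : ℕ) : 𝓞 K) ∉ v.asIdeal) (k : ℕ) :
    W.torsionFilAt v (((p : ℕ) : ℤ) ^ k) = ⊥ := by
  sorry

/-- **M0′ · `F⁺_v T_pE = ⊥` for `v ∤ p`** (from M0 level by level, `mem_tateModuleFilAt_iff_torsionFilAt`). [folklore] -/
theorem tateModuleFilAt_eq_bot_of_not_mem (hpv : ((p : ℕ) : 𝓞 K) ∉ v.asIdeal) :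
    tateModuleFilAt W p v = ⊥ := by
  sorry

end OffP

/-! ## §2 M1a / M1 — inertia moves `E(K̄_v)[p^∞]` and `T_pE` into the kernel of reduction at a MULTIPLICATIVE `v ∣ p` -/

section Inertia

variable {K : Type} [Field K] [NumberField K] (W : WeierstrassCurve K) [W.IsElliptic]
  (p : ℕ) [Fact p.Prime] (v : HeightOneSpectrum (𝓞 K))

/-- **M1a (PROVED; the perturbation of N2 off its extreme) · `τ • R − R ∈ E₁(K̄_v)` for `τ` in the inertia
group, `R ∈ E(K̄_v)` killed by `p^k`, at a place `v ∣ p` of MULTIPLICATIVE reduction (split or not), any number field.**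
Proof, every input a tree theorem: take the twisted Tate datum `(q, t, Ψ)` of
`TateCurve.exists_twistedTateUniformisation_localKernelOfReduction_iff W v hmult` (surjective `Ψ : K̄_vˣ → E(K̄_v)`,
`ker Ψ = q^ℤ`, `σ • Ψ(u) = ±Ψ(σu)` with sign `+` iff `σ t = t`, and `P ∈ E₁ ↔ P = Ψ(u)` with `|u − 1|_v < 1`);
`τ t = t` on the inertia group (`toAlgEquiv_eq_of_mem_inertia_of_sq_eq_gamma` with `inertia_eq_absInertia`, as in
liftFive-k3-g8's PROVED S0); write `R = Ψ(u)`; `p^k • R = 0` gives `u^{p^k} = q^m` (kernel clause), and `τ` fixes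
`q ∈ K_v`, so `ζ := τu · u⁻¹` has `ζ^{p^k} = 1`, hence `|ζ|_v = 1` and `|ζ − 1|_v < 1`
(`WeierstrassCurve.spectralValuation_sub_one_lt_one_of_pow hpv k`, residue characteristic `p`); finally
`τ • R − R = Ψ(τu) − Ψ(u) = Ψ(ζ) ∈ E₁` by the iff clause.  The extreme `q = y^{p^k}`, `τ ζ = ζ` is N2 (`ζ = 1`).
FALSE without `hpv` (§1). [cite: SilvermanATAEC1994, V Thm. 5.3, Ex. 5.13; proof of Prop. V.6.1 (PDF p. 411)]
[cite: SerreInventiones1972, §1.12, App. A.1.2] -/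
theorem smul_sub_mem_localKernelOfReduction_of_mem_absInertia_of_hasMultiplicativeReductionAt
    (hpv : ((p : ℕ) : 𝓞 K) ∈ v.asIdeal) (hmult : W.HasMultiplicativeReductionAt v)
    {τ : absoluteGaloisGroup (v.adicCompletion K)} (hτ : τ ∈ absInertia (v.adicCompletion K))
    (k : ℕ) (R : localPoints W (v.adicCompletion K)) (hR : (p ^ k) • R = 0) :
    τ • R - R ∈ W.localKernelOfReduction v := by
  have hp : p.Prime := Fact.out
  obtain ⟨q, t, Ψ, hq0, hq1, ht0, ht, hsurj, hker, hΨσ, hiff⟩ :=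
    exists_twistedTateUniformisation_localKernelOfReduction_iff W v hmult
  -- the unramified sign is `+1` on the inertia group (`K_v(√γ)/K_v` unramified)
  obtain ⟨w, hw⟩ := v.exists_spectralValuation
  obtain ⟨𝔐, h𝔐⟩ := v.localPrimesAbove_nonempty
  have hτ' : τ ∈ 𝔐.inertia (absoluteGaloisGroup (v.adicCompletion K)) := by
    rw [inertia_eq_absInertia hw h𝔐]; exact hτ
  have hτt : absoluteGaloisGroup.toAlgEquiv (v.adicCompletion K) τ t = t :=
    toAlgEquiv_eq_of_mem_inertia_of_sq_eq_gamma W hmult h𝔐 ht hτ'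
  -- `R = Ψ(u)`
  obtain ⟨a, rfl⟩ := hsurj R
  obtain ⟨u, rfl⟩ : ∃ u : (AlgebraicClosure (v.adicCompletion K))ˣ, Additive.ofMul u = a :=
    ⟨Additive.toMul a, rfl⟩
  -- `u ^ (p ^ k) ∈ q^ℤ`
  have h0 : Ψ (Additive.ofMul (u ^ p ^ k)) = 0 := by rw [ofMul_pow, map_nsmul, hR]
  obtain ⟨n, hn⟩ := (hker _).1 h0
  -- `τ u`, and `τ • Ψ(u) = Ψ(τ u)`
  set u' : (AlgebraicClosure (v.adicCompletion K))ˣ := Units.map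
    (absoluteGaloisGroup.toAlgEquiv (v.adicCompletion K) τ :
      AlgebraicClosure (v.adicCompletion K) →* AlgebraicClosure (v.adicCompletion K)) u with hu'
  have hτΨ : τ • Ψ (Additive.ofMul u) = Ψ (Additive.ofMul u') := by
    rw [hΨσ τ u, if_pos hτt, one_zsmul]
  -- `ζ := τu / u` is a `p^k`-th root of unity (`τ` fixes `q ∈ K_v`), hence a principal unit at `v ∣ p`
  have hτu : (absoluteGaloisGroup.toAlgEquiv (v.adicCompletion K) τ (u : AlgebraicClosure (v.adicCompletion K)))
      ^ p ^ k = (u : AlgebraicClosure (v.adicCompletion K)) ^ p ^ k := by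
    rw [← map_pow, ← Units.val_pow_eq_pow_val, hn, map_zpow₀, AlgEquiv.commutes]
  have hζ : ((u' * u⁻¹ : (AlgebraicClosure (v.adicCompletion K))ˣ) : AlgebraicClosure (v.adicCompletion K))
      ^ p ^ k = 1 := by
    rw [Units.val_mul, Units.val_inv_eq_inv_val, mul_pow, inv_pow, hu', Units.coe_map, MonoidHom.coe_coe, hτu,
      mul_inv_cancel₀ (pow_ne_zero _ u.ne_zero)]
  have hζ1 : v.spectralValuation
      ((u' * u⁻¹ : (AlgebraicClosure (v.adicCompletion K))ˣ) : AlgebraicClosure (v.adicCompletion K)) = 1 := by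
    have h1 : v.spectralValuation ((u' * u⁻¹ : (AlgebraicClosure (v.adicCompletion K))ˣ) :
        AlgebraicClosure (v.adicCompletion K)) ^ p ^ k = 1 := by
      rw [← map_pow, hζ, map_one]
    exact (pow_eq_one_iff_of_nonneg zero_le (pow_ne_zero _ hp.ne_zero)).mp h1
  have hζlt : v.spectralValuation
      (((u' * u⁻¹ : (AlgebraicClosure (v.adicCompletion K))ˣ) : AlgebraicClosure (v.adicCompletion K)) - 1) < 1 :=
    WeierstrassCurve.spectralValuation_sub_one_lt_one_of_pow hpv k hζ1
      (by rw [hζ, sub_self, map_zero]; exact one_pos)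
  -- `τ • Ψ(u) − Ψ(u) = Ψ(ζ) ∈ E₁`
  rw [hτΨ]
  have e : Ψ (Additive.ofMul u') - Ψ (Additive.ofMul u) = Ψ (Additive.ofMul (u' * u⁻¹)) := by
    rw [ofMul_mul, ofMul_inv, map_add, map_neg, sub_eq_add_neg]
  rw [e]
  exact (hiff _).mpr ⟨u' * u⁻¹, hζlt, rfl⟩

/-- **M1 (PROVED from M1a; = liftFive-k1 W1 clause (1) over any number field) · inertia moves every point of `T_pE`
inside `F⁺_v T_pE` at a MULTIPLICATIVE `v ∣ p`** — the multiplicative twin of the tree's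
`absGaloisRestrict_smul_sub_mem_tateModuleFilAt (hgood)`, component by component.
[cite: SilvermanATAEC1994, V Ex. 5.13 (a)] [cite: GreenbergLNM1716, §2 (pp. 82–83)] -/
theorem absGaloisRestrict_smul_sub_mem_tateModuleFilAt_of_hasMultiplicativeReductionAt
    (hpv : ((p : ℕ) : 𝓞 K) ∈ v.asIdeal) (hmult : W.HasMultiplicativeReductionAt v)
    {τ : absoluteGaloisGroup (v.adicCompletion K)} (hτ : τ ∈ absInertia (v.adicCompletion K))
    (a : W.tateModule p) :
    absGaloisRestrict K (v.adicCompletion K) τ • a - a ∈ tateModuleFilAt W p v := by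
  rw [mem_tateModuleFilAt_iff]
  intro k
  have ht : (p ^ k) • TateModule.proj p k a = 0 := by
    have h := (mem_geomTorsion_iff W _ _).mp (W.proj_tateModule_mem_geomTorsion p k a)
    rwa [natCast_zsmul] at h
  rw [map_sub, map_sub, TateModule.proj_smul_of_distribMulAction, ← WeierstrassCurve.resGal_eq_absGaloisRestrict,
    resGal_eq, pointsMapOfEmb_smul]
  refine smul_sub_mem_localKernelOfReduction_of_mem_absInertia_of_hasMultiplicativeReductionAt W p v hpv hmult
    hτ k _ ?_
  rw [← map_nsmul, ht, map_zero]

end Inertia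

/-! ## §3 M2 — `F⁺ ≠ ⊥` at a multiplicative `v ∣ p` over `ℚ`, from `det ρ = χ_cyc` (no inverse-limit construction) -/

section Rat

variable (W : WeierstrassCurve ℚ) [W.IsElliptic] (p : ℕ) [Fact p.Prime] (v : HeightOneSpectrum (𝓞 ℚ))

/-- **M2 (PROVED, any `p`) · `F⁺_v T_pE ≠ ⊥` at a MULTIPLICATIVE `v ∋ p` of `ℚ`.**  Proof: if `F⁺ = ⊥`, M1 says
the inertia group acts TRIVIALLY on `T_pE`, hence (denominators, `RationalTateModule.exists_smul_eq_toRational`,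
`rationalTateRepresentation_toRational`) on `V_pE`, so `det ρ_{E,p}(res σ) = 1` for every inertial `σ`; but
`det ρ_{E,p} = χ_p` (`det_rationalTateRepresentation_eq_cyclotomicCharacter`, `cyclotomicCharacter_absGaloisRestrict`)
and local Kronecker–Weber provides `σ₀` in the inertia group with `χ_p(σ₀) = 1 + p ≠ 1`
(`adicCompletion_rat_exists_mem_absInertia_cyclotomicCharacter_eq`, `ℚ`-only — the one reason M2 is stated over
`ℚ`; over `K` replace it by «`χ_p` is non-trivial on `I_{K_v}`»).  Replaces the inverse-limit construction of a
non-zero element of `T_p(E₁)` (liftFive W1b's route via `#Fil_v E[p^k] = p^k`). [cite: Greenberg1991, §2 (p. 214)]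
[cite: SilvermanAEC2009, III.8 Prop. 8.3 (det = χ via the Weil pairing)] -/
theorem tateModuleFilAt_ne_bot_of_hasMultiplicativeReductionAt (hpv : ((p : ℕ) : 𝓞 ℚ) ∈ v.asIdeal)
    (hmult : W.HasMultiplicativeReductionAt v) : tateModuleFilAt W p v ≠ ⊥ := by
  classical
  have hp : (p : ℕ).Prime := Fact.out
  intro hbot
  -- (1) the inertia group acts trivially on `T_pE` (M1 with `F⁺ = ⊥`)
  have h1 : ∀ τ ∈ absInertia (v.adicCompletion ℚ), ∀ a : W.tateModule p,
      absGaloisRestrict ℚ (v.adicCompletion ℚ) τ • a = a := by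
    intro τ hτ a
    have h := absGaloisRestrict_smul_sub_mem_tateModuleFilAt_of_hasMultiplicativeReductionAt W p v hpv hmult hτ a
    rw [hbot, Submodule.mem_bot, sub_eq_zero] at h
    exact h
  -- (2) hence trivially on `V_pE` (clear denominators)
  let ι : W.tateModule p →ₗ[ℤ_[p]] W.rationalTateModule p := TateModule.toRational p
  let ρV := W.rationalGaloisRepTate p
  let res := absGaloisRestrict ℚ (v.adicCompletion ℚ)
  have hιρ : ∀ (g : absoluteGaloisGroup ℚ) (x : W.tateModule p), ρV g (ι x) = ι (g • x) :=
    fun g x ↦ rationalTateRepresentation_toRational _ _ p g x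
  have h2 : ∀ τ ∈ absInertia (v.adicCompletion ℚ), ∀ y : W.rationalTateModule p, ρV (res τ) y = y := by
    intro τ hτ y
    obtain ⟨d, hd, x, hx⟩ := RationalTateModule.exists_smul_eq_toRational y
    have hd' : (d : ℚ_[p]) ≠ 0 := PadicInt.coe_ne_zero.mpr hd
    have h : ρV (res τ) ((d : ℚ_[p]) • y) = (d : ℚ_[p]) • y := by
      rw [hx, hιρ, h1 τ hτ x]
    rw [map_smul] at h
    exact smul_right_injective _ hd' h
  -- (3) an inertia element with `χ_p(σ₀) = 1 + p`
  obtain ⟨u₀, hu₀⟩ : ∃ u₀ : ℤ_[p]ˣ, (u₀ : ℤ_[p]) = 1 + p := by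
    rcases IsLocalRing.isUnit_or_isUnit_one_sub_self (1 + (p : ℤ_[p])) with h | h
    · exact ⟨h.unit, h.unit_spec⟩
    · exfalso
      have h' : (1 : ℤ_[p]) - (1 + p) = -p := by ring
      rw [h', IsUnit.neg_iff] at h
      exact PadicInt.prime_p.not_unit h
  have hvp : (Rat.HeightOneSpectrum.primesEquiv v : ℕ) = p := by
    have hd : Rat.HeightOneSpectrum.natGenerator v ∣ p := by
      rw [Rat.HeightOneSpectrum.natGenerator_dvd_iff, Ideal.mem_map_of_equiv]
      exact ⟨p, hpv, map_natCast _ p⟩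
    exact (Nat.prime_dvd_prime_iff_eq (Rat.HeightOneSpectrum.prime_natGenerator v) hp).mp hd
  obtain ⟨σ₀, hσ₀I, hχ₀⟩ := adicCompletion_rat_exists_mem_absInertia_cyclotomicCharacter_eq p v hvp u₀
  -- (4) `det ρ(res σ₀) = χ_p(σ₀) = 1 + p`, but `ρ(res σ₀) = id`
  have hid : ρV (res σ₀) = LinearMap.id := LinearMap.ext (h2 σ₀ hσ₀I)
  have hdet : LinearMap.det (ρV (res σ₀)) =
      (((GaloisRep.cyclotomicCharacter ℚ p (res σ₀) : ℤ_[p]ˣ) : ℤ_[p]) : ℚ_[p]) :=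
    det_rationalTateRepresentation_eq_cyclotomicCharacter W p (res σ₀)
  rw [hid, LinearMap.det_id, cyclotomicCharacter_absGaloisRestrict, hχ₀, hu₀] at hdet
  have hp0 : (p : ℚ_[p]) ≠ 0 := Nat.cast_ne_zero.mpr hp.ne_zero
  apply hp0
  have e : ((1 + p : ℤ_[p]) : ℚ_[p]) = 1 + p := by push_cast; ring
  rw [e] at hdet
  linear_combination -hdet

end Rat

/-! ## §4 M3 — a point of `T_3E` outside `F⁺` at a multiplicative `v ∋ 3` (PROVED, from N3) -/

section Three

variable {K : Type} [Field K] [NumberField K] (W : WeierstrassCurve K) [W.IsElliptic]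
  (v : HeightOneSpectrum (𝓞 K))

/-- **M3 (PROVED, XS) · some `a ∈ T_3E` lies outside `F⁺_v T_3E` at a MULTIPLICATIVE `v ∋ 3`**: lift the tree's
ordinary `3`-torsion point (`exists_not_mem_torsionFilAt_of_hasMultiplicativeReductionAt_three`) to `T_3E`
(`proj_surjective_of_isAlgClosed_holds`).  At a general `p` the same two lines need liftFive-k3-g8's B2
(`exists_not_mem_torsionFilAt_of_hasMultiplicativeReductionAt`, port of the `p = 3` file). [cite: GreenbergLNM1716, §1 p. 62] -/
theorem exists_not_mem_tateModuleFilAt_of_hasMultiplicativeReductionAt_three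
    (h3v : ((3 : ℕ) : 𝓞 K) ∈ v.asIdeal) (hmult : W.HasMultiplicativeReductionAt v) :
    ∃ a : W.tateModule 3, a ∉ tateModuleFilAt W 3 v := by
  obtain ⟨Q, hQ⟩ := W.exists_not_mem_torsionFilAt_of_hasMultiplicativeReductionAt_three v h3v hmult
  have hQ3 : (Q : geomPoints W) ∈ geomTorsion W ((3 ^ 1 : ℕ) : ℤ) := by
    rw [pow_one]; exact Q.2
  obtain ⟨a, ha⟩ := W.proj_surjective_of_isAlgClosed_holds 3 1 (P := (Q : geomPoints W)) hQ3
  refine ⟨a, fun haF ↦ hQ ?_⟩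
  have h1 := (mem_tateModuleFilAt_iff W 3 v a).mp haF 1
  rw [ha] at h1
  exact (W.mem_torsionFilAt_iff v _ Q).mpr h1

end Three

/-! ## §5 M4 / M5 — L2 at `p = 3` over `ℚ` and the integral scalar law, by running the template of
`tateModuleFilAt_inertia_ordinary_holds` on M1–M3 (denominator lemmas D1/D2 = verbatim copies of the tree's
`private` ones in `TateModuleFilAtInertiaProofs` — request: make them public) -/

section Denominators

/-- D1 (= the tree's private `exists_pow_mul_eq_coe_padicInt`, verbatim). [folklore] -/
theorem exists_pow_mul_eq_coe_padicInt (p : ℕ) [Fact p.Prime] (c : ℚ_[p]) :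
    ∃ (m : ℕ) (d : ℤ_[p]), (p : ℚ_[p]) ^ m * c = d := by
  by_cases hc : c = 0
  · exact ⟨0, 0, by simp [hc]⟩
  have hcpos : 0 < ‖c‖ := norm_pos_iff.mpr hc
  obtain ⟨k, hk⟩ := PadicInt.exists_pow_neg_lt p (ε := ‖c‖⁻¹) (inv_pos.mpr hcpos)
  refine ⟨k, ⟨(p : ℚ_[p]) ^ k * c, ?_⟩, rfl⟩
  rw [norm_mul, Padic.norm_p_pow]
  calc (p : ℝ) ^ (-(k : ℤ)) * ‖c‖ ≤ ‖c‖⁻¹ * ‖c‖ := mul_le_mul_of_nonneg_right hk.le hcpos.le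
    _ = 1 := inv_mul_cancel₀ hcpos.ne'

/-- D2 (= the tree's private `exists_pow_smul_eq_of_mem_span`, verbatim): denominators in the `ℚ_p`-span of an
integral submodule. [folklore] -/
theorem exists_pow_smul_eq_of_mem_span (p : ℕ) [Fact p.Prime] {T V : Type*} [AddCommGroup T] [Module ℤ_[p] T]
    [AddCommGroup V] [Module ℚ_[p] V] [Module ℤ_[p] V] [IsScalarTower ℤ_[p] ℚ_[p] V]
    (ι : T →ₗ[ℤ_[p]] V) (N : Submodule ℤ_[p] T) {y : V}
    (hy : y ∈ Submodule.span ℚ_[p] (ι '' (N : Set T))) :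
    ∃ (n : ℕ) (x : T), x ∈ N ∧ ((p : ℚ_[p]) ^ n) • y = ι x := by
  have hsc : ∀ (d : ℤ_[p]) (z : V), ((d : ℚ_[p])) • z = d • z := fun d z ↦ algebraMap_smul ℚ_[p] d z
  induction hy using Submodule.span_induction with
  | mem z hz =>
    obtain ⟨x, hx, rfl⟩ := hz
    exact ⟨0, x, hx, by simp⟩
  | zero => exact ⟨0, 0, N.zero_mem, by simp⟩
  | add y z _ _ hy hz =>
    obtain ⟨n₁, x₁, hx₁, h₁⟩ := hy
    obtain ⟨n₂, x₂, hx₂, h₂⟩ := hz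
    refine ⟨n₁ + n₂, (p : ℤ_[p]) ^ n₂ • x₁ + (p : ℤ_[p]) ^ n₁ • x₂,
      N.add_mem (N.smul_mem _ hx₁) (N.smul_mem _ hx₂), ?_⟩
    rw [smul_add, map_add, map_smul, map_smul, ← h₁, ← h₂, ← hsc, ← hsc, smul_smul, smul_smul]
    push_cast
    ring_nf
  | smul c y _ hy =>
    obtain ⟨n, x, hx, h⟩ := hy
    obtain ⟨m, d, hd⟩ := exists_pow_mul_eq_coe_padicInt p c
    refine ⟨m + n, d • x, N.smul_mem _ hx, ?_⟩
    rw [map_smul, ← hsc, ← h, smul_smul, smul_smul, ← hd]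
    ring_nf

end Denominators

section Assembly

variable (W : WeierstrassCurve ℚ) [W.IsElliptic] (v : HeightOneSpectrum (𝓞 ℚ))

/-- The candidate line `F := ℚ₃ · ι(F⁺_v T_3E) ⊂ V_3E` (`ι = TateModule.toRational 3`). -/
def spanFilThree : Submodule ℚ_[3] (W.rationalTateModule 3) :=
  Submodule.span ℚ_[3]
    ((TateModule.toRational 3 : W.tateModule 3 →ₗ[ℤ_[3]] W.rationalTateModule 3) ''
      (tateModuleFilAt W 3 v : Set (W.tateModule 3)))

/-- **M4core (PROVED from M1, M2, M3 by the template of `tateModuleFilAt_inertia_ordinary_holds`) · at a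
MULTIPLICATIVE `v ∋ 3` of `ℚ` the line `F = ℚ₃ · ι(F⁺)` is `Γ_{ℚ_v}`-stable of dimension `1`, the inertia group acts on it
through `χ_3` and trivially on `V_3E / F`.**  Steps: `(i)` quotient clause — M1 + denominators; stability —
`smul_mem_tateModuleFilAt` + span induction; `(ii′)` `F ≠ ⊥` — M2; `(iii)` `F ≠ ⊤` — M3 + `tateModuleFilAt_saturated` + D2;
`(iv)` `finrank V = 2`; `(v)` scalar on `F` = `det = χ_3` (`LinearMap.eq_det_smul_of_mem_of_finrank_eq_one`,
`det_rationalTateRepresentation_eq_cyclotomicCharacter`, `cyclotomicCharacter_absGaloisRestrict`).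
[cite: Greenberg1991, §2 (p. 214)] [cite: DDT1995, Prop. 2.12 (c) (p. 57)] [cite: SilvermanATAEC1994, V Ex. 5.13] -/
theorem spanFilThree_ordinary (h3v : ((3 : ℕ) : 𝓞 ℚ) ∈ v.asIdeal) (hmult : W.HasMultiplicativeReductionAt v) :
    Module.finrank ℚ_[3] (spanFilThree W v) = 1 ∧
    (∀ (τ : absoluteGaloisGroup (v.adicCompletion ℚ)), ∀ x ∈ spanFilThree W v,
      W.rationalGaloisRepTate 3 (absGaloisRestrict ℚ (v.adicCompletion ℚ) τ) x ∈ spanFilThree W v) ∧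
    (∀ τ ∈ absInertia (v.adicCompletion ℚ), ∀ x ∈ spanFilThree W v,
      W.rationalGaloisRepTate 3 (absGaloisRestrict ℚ (v.adicCompletion ℚ) τ) x =
        (((GaloisRep.cyclotomicCharacter (v.adicCompletion ℚ) 3 τ : (PadicInt 3)ˣ) : PadicInt 3) :
          Padic 3) • x) ∧
    (∀ τ ∈ absInertia (v.adicCompletion ℚ), ∀ x : W.rationalTateModule 3,
      W.rationalGaloisRepTate 3 (absGaloisRestrict ℚ (v.adicCompletion ℚ) τ) x - x ∈ spanFilThree W v) := by
  classical
  -- notation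
  set N : Submodule ℤ_[3] (W.tateModule 3) := tateModuleFilAt W 3 v with hN
  let ι : W.tateModule 3 →ₗ[ℤ_[3]] W.rationalTateModule 3 := TateModule.toRational 3
  let ρV := W.rationalGaloisRepTate 3
  let res := absGaloisRestrict ℚ (v.adicCompletion ℚ)
  have hιρ : ∀ (g : absoluteGaloisGroup ℚ) (x : W.tateModule 3), ρV g (ι x) = ι (g • x) :=
    fun g x ↦ rationalTateRepresentation_toRational _ _ 3 g x
  have hsc : ∀ (d : ℤ_[3]) (z : W.rationalTateModule 3), ((d : ℚ_[3])) • z = d • z :=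
    fun d z ↦ algebraMap_smul ℚ_[3] d z
  have hιinj : Function.Injective ι := TateModule.toRational_injective
  -- M1
  have h1 : ∀ τ ∈ absInertia (v.adicCompletion ℚ), ∀ a : W.tateModule 3, res τ • a - a ∈ N := fun τ hτ a ↦
    absGaloisRestrict_smul_sub_mem_tateModuleFilAt_of_hasMultiplicativeReductionAt W 3 v h3v hmult hτ a
  -- `F = ℚ₃ · ι(F⁺)`
  set F : Submodule ℚ_[3] (W.rationalTateModule 3) := spanFilThree W v with hF
  have hFdef : F = Submodule.span ℚ_[3] (ι '' (N : Set (W.tateModule 3))) := rfl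
  have hιN : ∀ x ∈ N, ι x ∈ F := fun x hx ↦ by
    rw [hFdef]; exact Submodule.subset_span ⟨x, hx, rfl⟩
  -- (i) the inertia group acts trivially on `V/F` (clear denominators, then M1)
  have hquotF : ∀ τ ∈ absInertia (v.adicCompletion ℚ), ∀ y : W.rationalTateModule 3,
      ρV (res τ) y - y ∈ F := by
    intro τ hτ y
    obtain ⟨d, hd, x, hx⟩ := RationalTateModule.exists_smul_eq_toRational y
    have hd' : (d : ℚ_[3]) ≠ 0 := PadicInt.coe_ne_zero.mpr hd
    have hmem : ρV (res τ) ((d : ℚ_[3]) • y) - (d : ℚ_[3]) • y ∈ F := by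
      rw [hx, hιρ, ← map_sub]
      exact hιN _ (h1 τ hτ x)
    rw [map_smul, ← smul_sub] at hmem
    have := F.smul_mem ((d : ℚ_[3]))⁻¹ hmem
    rwa [smul_smul, inv_mul_cancel₀ hd', one_smul] at this
  -- stability under the whole decomposition group
  have hstab : ∀ (τ : absoluteGaloisGroup (v.adicCompletion ℚ)), ∀ y ∈ F, ρV (res τ) y ∈ F := by
    intro τ y hy
    rw [hFdef] at hy ⊢
    induction hy using Submodule.span_induction with
    | mem z hz =>
      obtain ⟨x, hx, rfl⟩ := hz
      rw [hιρ]
      exact Submodule.subset_span ⟨_, smul_mem_tateModuleFilAt W 3 v τ hx, rfl⟩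
    | zero => rw [map_zero]; exact Submodule.zero_mem _
    | add y z _ _ hy hz => rw [map_add]; exact Submodule.add_mem _ hy hz
    | smul c y _ hy => rw [map_smul]; exact Submodule.smul_mem _ c hy
  -- (ii′) `F ≠ ⊥` (M2)
  have hFbot : F ≠ ⊥ := by
    intro hbot
    apply tateModuleFilAt_ne_bot_of_hasMultiplicativeReductionAt W 3 v h3v hmult
    rw [eq_bot_iff]
    intro x hx
    have hιx : ι x ∈ F := hιN x hx
    rw [hbot, Submodule.mem_bot] at hιx
    rw [Submodule.mem_bot]
    exact hιinj (by rw [hιx, map_zero])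
  -- (iii) `F ≠ ⊤` (M3: a point outside the saturated `F⁺`)
  have hFtop : F ≠ ⊤ := by
    obtain ⟨a, haN⟩ := exists_not_mem_tateModuleFilAt_of_hasMultiplicativeReductionAt_three W v h3v hmult
    intro htop
    have haF : ι a ∈ Submodule.span ℚ_[3] (ι '' (N : Set (W.tateModule 3))) := by
      rw [← hFdef, htop]; exact Submodule.mem_top
    obtain ⟨n, x, hx, hnx⟩ := exists_pow_smul_eq_of_mem_span 3 ι N haF
    have hna : (((3 : ℕ) : ℤ_[3]) ^ n) • a ∈ N := by
      have e : ι ((((3 : ℕ) : ℤ_[3]) ^ n) • a) = ι x := by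
        rw [map_smul, ← hnx, ← hsc]; push_cast; rfl
      rwa [← hιinj e] at hx
    exact haN (tateModuleFilAt_saturated W 3 v n hna)
  -- (iv) dimension count
  have hV2 : Module.finrank ℚ_[3] (W.rationalTateModule 3) = 2 :=
    W.finrank_rationalTateModule_eq_two_holds 3 (by norm_num)
  haveI : Module.Finite ℚ_[3] (W.rationalTateModule 3) := Module.finite_of_finrank_eq_succ hV2
  have hFlt : Module.finrank ℚ_[3] F < 2 := hV2 ▸ Submodule.finrank_lt hFtop
  have hF0 : Module.finrank ℚ_[3] F ≠ 0 := fun h ↦ hFbot (Submodule.finrank_eq_zero.mp h)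
  have hF1 : Module.finrank ℚ_[3] F = 1 := by omega
  refine ⟨hF1, hstab, ?_, hquotF⟩
  -- (v) on `F` an inertial `τ` acts by `det ρ(res τ) = χ_3(τ)`
  intro τ hτ x hx
  have key := LinearMap.eq_det_smul_of_mem_of_finrank_eq_one F hF1 (ρV (res τ)) (hstab τ) (hquotF τ hτ) x hx
  have hdet : LinearMap.det (ρV (res τ)) =
      (((GaloisRep.cyclotomicCharacter ℚ 3 (res τ) : ℤ_[3]ˣ) : ℤ_[3]) : ℚ_[3]) :=
    det_rationalTateRepresentation_eq_cyclotomicCharacter W 3 (res τ)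
  rw [cyclotomicCharacter_absGaloisRestrict] at hdet
  rw [key, hdet]

/-- **M4 = gen-7 L2 at `p = 3` over `ℚ` = liftFive P2 at `(ℚ, 3)` (PROVED modulo nothing: M1–M3 are proved above).**
Consumer: gen-7 L2f / liftFive A3 frame lemma ⇒ `FramedGaloisRep.IsOrdinaryOfWeightAt 3 (W.framedTateGaloisRep 3) v 2 1`,
the hypothesis shape of the ordinary `R = T` cells (gen-8 §3). [cite: Greenberg1991, §2 (p. 214)]
[cite: DDT1995, Prop. 2.12 (c) (p. 57)] [cite: Diamond1996, §1] -/
theorem hasOrdinaryLineAt_three_of_hasMultiplicativeReductionAt (h3v : ((3 : ℕ) : 𝓞 ℚ) ∈ v.asIdeal)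
    (hmult : W.HasMultiplicativeReductionAt v) : HasOrdinaryLineAt W 3 v :=
  ⟨spanFilThree W v, spanFilThree_ordinary W v h3v hmult⟩

/-- **M5 = liftFive-k1 W1 clause (2) at `p = 3` (PROVED: clause 3 of M4core pulled back along `ι`) · the inertia
group acts on `F⁺_v T_3E` through `χ_cyc` at a MULTIPLICATIVE `v ∋ 3`.**  With M1 this is VERBATIM the conclusion of
the named fact `Kato2004.tateModuleFilAt_inertia_ordinary` with `IsOrdinaryAt W p` replaced by multiplicative reduction at
`v ∋ 3` — the integral currency of k1's Wiles-datum plans. [cite: GreenbergLNM1716, §2] -/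
theorem absGaloisRestrict_smul_eq_cyclotomicCharacter_smul_of_hasMultiplicativeReductionAt_three
    (h3v : ((3 : ℕ) : 𝓞 ℚ) ∈ v.asIdeal) (hmult : W.HasMultiplicativeReductionAt v)
    {σ : absoluteGaloisGroup (v.adicCompletion ℚ)} (hσ : σ ∈ absInertia (v.adicCompletion ℚ))
    (a : W.tateModule 3) (ha : a ∈ tateModuleFilAt W 3 v) :
    absGaloisRestrict ℚ (v.adicCompletion ℚ) σ • a =
      ((GaloisRep.cyclotomicCharacter (v.adicCompletion ℚ) 3 σ : ℤ_[3]ˣ) : ℤ_[3]) • a := by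
  obtain ⟨-, -, hχ, -⟩ := spanFilThree_ordinary W v h3v hmult
  let ι : W.tateModule 3 →ₗ[ℤ_[3]] W.rationalTateModule 3 := TateModule.toRational 3
  have hιinj : Function.Injective ι := TateModule.toRational_injective
  have hιa : ι a ∈ spanFilThree W v := Submodule.subset_span ⟨a, ha, rfl⟩
  have key := hχ σ hσ (ι a) hιa
  have hιρ : W.rationalGaloisRepTate 3 (absGaloisRestrict ℚ (v.adicCompletion ℚ) σ) (ι a) =
      ι (absGaloisRestrict ℚ (v.adicCompletion ℚ) σ • a) :=
    rationalTateRepresentation_toRational _ _ 3 _ a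
  have hsc : ∀ (d : ℤ_[3]) (z : W.rationalTateModule 3), ((d : ℚ_[3])) • z = d • z :=
    fun d z ↦ algebraMap_smul ℚ_[3] d z
  rw [hιρ, hsc, ← map_smul] at key
  exact hιinj key

end Assembly

end Summit.ABC.ABC.Cruxes.FreyModularity.StubIdeas3G9

end
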